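import Literature.Geometry.Lorentzian.CauchyHypersurfaceCausalProofs
import Literature.Geometry.Lorentzian.CauchyHypersurfaceRetraction
import Literature.Geometry.Lorentzian.OpensCausality
import Literature.Geometry.Lorentzian.IdealPoints
import HarnessLib

/-!
# The Cauchy development of a piece of a Cauchy hypersurface: the Cauchy property

Let `S` be a Cauchy hypersurface of the time-oriented Lorentzian manifold `(M, g, τ)` (Hausdorff,
second countable, without boundary, finite-dimensional model, `C²` metric) and `A ⊆ S`. Put

  `F = I⁺(S ∖ A) ∪ I⁻(S ∖ A) ∪ (S ∖ A)`,

the set of points from which some timelike curve reaches `S` off `A` (together with `S ∖ A`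
itself). Every open `V ⊇ A` in which `A` is a Cauchy hypersurface must avoid `F`; the largest
candidate is the open set `M ∖ closure F` — for `A` an open ball in the slice `{t = 0}` of
Minkowski space this is the open double cone over `A`, the interior of the Cauchy development
`D(A)` (Hawking–Ellis 1973, §6.5; O'Neill 1983, Ch. 14, Def. 14.35). We prove:

* `LorentzianMetric.IsCauchyHypersurface.restrict_of_disjoint_closure` — if `V ⊇ A` is open,
  disjoint from `closure F` and relatively closed in `M ∖ closure F`, then `A` is a Cauchy
  hypersurface of the open sub-spacetime `(V, g|_V, τ|_V)`;
* `LorentzianMetric.IsCauchyHypersurface.restrict_compl_closure` — in particular, if `A` does not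
  meet `closure F`, then `A` is a Cauchy hypersurface of `M ∖ closure F ⊇ A`;
* `LorentzianMetric.IsCauchyHypersurface.exists_isConnected_restrict` — and, for preconnected `A`
  (and `M` locally connected), of the connected component of `M ∖ closure F` containing `A`.

The hypothesis `Disjoint A (closure F)` holds for relatively open pieces `A` of a smooth
*spacelike* Cauchy hypersurface (a separate, local statement); it fails for pieces of merely
achronal ones (a null segment of `S` meeting `A`). These statements are the form in which the
domain of dependence of an open piece of the Cauchy hypersurface of a Cauchy development is used
by the Choquet-Bruhat–Geroch theory (sub-data developments; Sbierski 2016, proof of Thm. 3.5: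
"suitable neighbourhoods of `S` in `M` … are GHDs of `(S, ḡ_S, k_S)`").

**The endpoint property.** The proofs use one local fact about timelike curves, taken here as the
displayed hypotheses `hE` (for `τ`) and `hE'` (for `τ.reverse`): *a past endpoint `e` of a future
timelike curve `c` on an interval `s` satisfies `e ≪ c t'` for all `t < t'` in `s`* (O'Neill 1983,
Ch. 14, proof of Lemma 14.6 with Lemma 5.33: inside a normal neighbourhood of `e` the curve lies in
the causal cone of `e`). It is discharged separately (exponential map, two-point inverse); keeping
it displayed makes the present file pure causality theory.

**Proof** (`false_of_curve_in_cauchyPieceDomain`, replacing the limit-curve arguments of the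
printed proofs). Let `c` be a future timelike curve in `V` without past endpoint in `V`, missing
`S`, through a point of `I⁺(S)`; then `c ⊆ I⁺(S)` (connectedness, `M ∖ S = I⁺(S) ⊔ I⁻(S)`). If `c`
has no past endpoint in `M`, its endless future extension (`exists_isEndlessTimelikeCurve_extends_future`)
stays in `I⁺(S)` off `c` and meets `S` — against achronality. Otherwise its past endpoint `e` lies in
`closure V ∖ V ⊆ closure F`, in `I⁺(S)` (it is neither in `A ⊆ V`, nor in `S ∖ A` — then
`c t₀ ∈ I⁺(S ∖ A) ⊆ F` by `hE` —, nor in the open set `I⁻(S)` disjoint from `I⁺(S) ⊇ c`), and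
`e ≪ c t₀` by `hE`; so the open neighbourhood `I⁻(c t₀) ∩ I⁺(S)` of `e` contains a point `f ∈ F`:
`f ∈ I⁺(S ∖ A) ∪ (S ∖ A)` gives `c t₀ ∈ I⁺(S ∖ A) ⊆ F`, `f ∈ I⁻(S ∖ A) ⊆ I⁻(S)` contradicts
`f ∈ I⁺(S)`. The past case is the future case for `τ.reverse` and the reversed parameter.

Everything is proved; no definitions, no named facts (D-0026).

## References

* S. W. Hawking, G. F. R. Ellis, *The large scale structure of space-time*, CUP 1973, §6.5
  (Cauchy developments), §6.6, Prop. 6.6.3, 6.6.6, 6.6.7. [HawkingEllis1973CUP]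
* B. O'Neill, *Semi-Riemannian geometry with applications to relativity*, Academic Press 1983,
  Ch. 14, Def. 14.35, Thm. 14.38, Lemma 14.43 (pp. 419–426). [ONeillSemiRiemannian1983]
* J. Sbierski, Ann. Henri Poincaré 17 (2016) 301–329 = arXiv:1309.7591, §3.2, proof of Thm. 3.5
  (arXiv Thm. 12). [Sbierski2016AHP]
-/

noncomputable section

open Bundle Set Filter Function Topology TopologicalSpace
open scoped Manifold ContDiff Topology

namespace Literature.Geometry.Lorentzian

variable {E : Type*} [NormedAddCommGroup E] [NormedSpace ℝ E] {H : Type*} [TopologicalSpace H]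
  {I : ModelWithCorners ℝ E H} {n : ℕ∞ω} {M : Type*} [TopologicalSpace M] [ChartedSpace H M]
  [IsManifold I ∞ M]

namespace LorentzianMetric

variable {g : LorentzianMetric I n M} {τ : TimeOrientation g}

/-! ### Elementary facts -/

omit [IsManifold I ∞ M] in
/-- A curve whose parameter set has a least element `t₁` has the past endpoint `γ t₁`
(time dual of `hasFutureEndpoint_of_isGreatest`). Hawking–Ellis 1973, §6.2, p. 184. [cite: HawkingEllis1973CUP, §6.2, p. 184] -/
lemma _root_.Literature.Geometry.Lorentzian.hasPastEndpoint_of_isLeast {γ : ℝ → M} {s : Set ℝ}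
    {t₁ : ℝ} (h : IsLeast s t₁) : HasPastEndpoint γ s (γ t₁) :=
  tendsto_atBot_of_eventually_const (i₀ := (⟨t₁, h.1⟩ : s)) fun i hi ↦
    congrArg γ (le_antisymm hi (h.2 i.2))

omit [IsManifold I ∞ M] in
/-- A past endpoint of a curve lies in the closure of any set containing the curve. [folklore] -/
lemma _root_.Literature.Geometry.Lorentzian.HasPastEndpoint.mem_closure {γ : ℝ → M} {s : Set ℝ}
    {p : M} (h : HasPastEndpoint γ s p) (hs : s.Nonempty) {V : Set M} (hV : ∀ t ∈ s, γ t ∈ V) :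
    p ∈ closure V := by
  haveI : Nonempty s := hs.to_subtype
  exact mem_closure_of_tendsto h (Eventually.of_forall fun t ↦ hV t t.2)

omit [IsManifold I ∞ M] in
/-- Along a curve with past endpoint `p`, every neighbourhood of `p` contains a point of the curve.
[folklore] -/
lemma _root_.Literature.Geometry.Lorentzian.HasPastEndpoint.exists_mem_of_mem_nhds {γ : ℝ → M}
    {s : Set ℝ} {p : M} (h : HasPastEndpoint γ s p) (hs : s.Nonempty) {N : Set M} (hN : N ∈ 𝓝 p) :
    ∃ t ∈ s, γ t ∈ N := by
  haveI : Nonempty s := hs.to_subtype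
  obtain ⟨t, ht⟩ := (h.eventually (eventually_mem_set.2 hN)).exists
  exact ⟨t, t.2, ht⟩

/-- For an achronal set `S`, the chronological future and past of `S` are disjoint.
O'Neill 1983, Ch. 14, p. 413. [cite: ONeillSemiRiemannian1983, Ch. 14, p. 413] -/
lemma IsAchronal.disjoint_chronologicalFuture_chronologicalPast {S : Set M}
    (hA : g.IsAchronal τ S) :
    Disjoint (g.chronologicalFuture τ S) (g.chronologicalPast τ S) :=
  Set.disjoint_left.2 fun _ hy ↦ hA.not_mem_chronologicalPast_of_mem_chronologicalFuture hy

/-! ### The key lemma: no timelike curve of the region runs down to its boundary above `S` -/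

section Aux

variable [T2Space M] [SecondCountableTopology M] [BoundarylessManifold I M] [FiniteDimensional ℝ E]

/-- **Key lemma.** Let `S` be a Cauchy hypersurface, `A ⊆ S`, and put
`F = I⁺(S ∖ A) ∪ I⁻(S ∖ A) ∪ (S ∖ A)`. Let `V ⊇ A` be open, disjoint from `closure F` and
relatively closed in its complement. Suppose the time-oriented metric has the *endpoint property*
`hE` (a past endpoint of a future timelike curve lies in the chronological past of its later
points). Then no future timelike curve `c` on an interval `s`, with values in `V`, missing `S`,
without past endpoint in `V`, has a point in `I⁺(S)`. Hawking–Ellis 1973, §6.5 (the interior of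
the Cauchy development); O'Neill 1983, Ch. 14, Lemma 14.43. [cite: HawkingEllis1973CUP, §6.5–6.6] -/
theorem false_of_curve_in_cauchyPieceDomain (hn : 2 ≤ n)
    (hE : ∀ {c : ℝ → M} {s : Set ℝ} {e : M} {t t' : ℝ}, s.OrdConnected →
      g.IsFutureTimelikeCurveOn τ c s → HasPastEndpoint c s e → t ∈ s → t' ∈ s → t < t' →
      c t' ∈ g.chronologicalFuture τ {e})
    {S A V : Set M} (hS : g.IsCauchyHypersurface τ S) (hAV : A ⊆ V)
    (hVF : Disjoint V (closure (g.chronologicalFuture τ (S \ A) ∪ g.chronologicalPast τ (S \ A) ∪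
      (S \ A))))
    (hVcl : closure V \ closure (g.chronologicalFuture τ (S \ A) ∪ g.chronologicalPast τ (S \ A) ∪
      (S \ A)) ⊆ V)
    {c : ℝ → M} {s : Set ℝ} (hs : s.OrdConnected) (hc : g.IsFutureTimelikeCurveOn τ c s)
    (hcV : ∀ t ∈ s, c t ∈ V) (hmiss : ∀ t ∈ s, c t ∉ S) (hend : ∀ e ∈ V, ¬ HasPastEndpoint c s e)
    {t₀ : ℝ} (ht₀ : t₀ ∈ s) (hp : c t₀ ∈ g.chronologicalFuture τ S) : False := by
  set F : Set M := g.chronologicalFuture τ (S \ A) ∪ g.chronologicalPast τ (S \ A) ∪ (S \ A)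
    with hF_def
  have hA : g.IsAchronal τ S := IsCauchyHypersurface.isAchronal_holds hn hS
  have hdisjA : Disjoint (g.chronologicalFuture τ S) S := (isAchronal_iff_disjoint S).mp hA
  have hdisj : Disjoint (g.chronologicalFuture τ S) (g.chronologicalPast τ S) :=
    hA.disjoint_chronologicalFuture_chronologicalPast
  have hVF' : ∀ x ∈ V, x ∉ F := fun x hxV hxF ↦
    Set.disjoint_left.1 hVF hxV (subset_closure hxF)
  -- Step 1: the whole curve lies in `I⁺(S)`
  have hIJ : ∀ t ∈ s, c t ∈ g.chronologicalFuture τ S := by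
    have himg : c '' s ⊆ g.chronologicalFuture τ S ∪ g.chronologicalPast τ S := by
      rintro _ ⟨t, ht, rfl⟩
      exact hS.mem_chronologicalFuture_union_chronologicalPast hn (hmiss t ht)
    have hconn : IsPreconnected (c '' s) :=
      hs.isPreconnected.image c fun t ht ↦ (hc t ht).1.continuousAt.continuousWithinAt
    rcases hconn.subset_or_subset (isOpen_chronologicalFuture_of_boundaryless g τ S)
      (isOpen_chronologicalPast_of_boundaryless g τ S) hdisj himg with h | h
    · exact fun t ht ↦ h (mem_image_of_mem c ht)
    · exact absurd (h (mem_image_of_mem c ht₀)) (Set.disjoint_left.mp hdisj hp)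
  -- Step 2: the past part of the curve
  set J : Set ℝ := s ∩ Iic t₀ with hJ_def
  have hJ : J.OrdConnected := hs.inter ordConnected_Iic
  have ht₀J : t₀ ∈ J := ⟨ht₀, mem_Iic.mpr le_rfl⟩
  have hJs : J ⊆ s := inter_subset_left
  have hcJ : g.IsFutureTimelikeCurveOn τ c J := hc.mono hJs
  have hcongr : ∀ e, HasPastEndpoint c J e ↔ HasPastEndpoint c s e := fun e ↦
    hasPastEndpoint_congr_set ht₀J ht₀ (fun t ht ↦ ⟨fun h ↦ h.1, fun h ↦ ⟨h, ht⟩⟩) e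
  by_cases hendJ : IsPastEndless c J
  · -- Case A: no past endpoint at all — extend to the future and meet `S` above `I⁺(S)`
    obtain ⟨Δ, D', hΔ, hJD', hΔJ, hΔI⟩ :=
      exists_isEndlessTimelikeCurve_extends_future hn hJ ht₀J (fun t ht ↦ ht.2) hcJ hendJ
    obtain ⟨t₁, ⟨ht₁, ht₁S⟩, -⟩ := hS Δ D' hΔ
    by_cases ht₁J : t₁ ∈ J
    · rw [hΔJ t₁ ht₁J] at ht₁S
      exact hmiss t₁ (hJs ht₁J) ht₁S
    · have h1 : Δ t₁ ∈ g.chronologicalFuture τ S :=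
        mem_chronologicalFuture_trans hp (hΔI t₁ ht₁ ht₁J)
      exact Set.disjoint_left.mp hdisjA h1 ht₁S
  · -- Case B: a past endpoint `e` of the past part
    have hex : ∃ e, HasPastEndpoint c J e := by
      by_contra h
      push Not at h
      exact hendJ ⟨⟨t₀, ht₀J⟩, h⟩
    obtain ⟨e, he⟩ := hex
    have heV : e ∉ V := fun heV ↦ hend e heV ((hcongr e).1 he)
    have hecl : e ∈ closure V := he.mem_closure ⟨t₀, ht₀J⟩ fun t ht ↦ hcV t (hJs ht)
    have heF : e ∈ closure F := by
      by_contra h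
      exact heV (hVcl ⟨hecl, h⟩)
    -- `J` has no least element (its image would be a past endpoint inside `V`)
    obtain ⟨t₁, ht₁J, ht₁₀⟩ : ∃ t₁ ∈ J, t₁ < t₀ := by
      by_contra h
      push Not at h
      have hleast : IsLeast J t₀ := ⟨ht₀J, h⟩
      have h' : HasPastEndpoint c J (c t₀) := hasPastEndpoint_of_isLeast hleast
      haveI : Nonempty J := ⟨⟨t₀, ht₀J⟩⟩
      have : e = c t₀ := tendsto_nhds_unique he h'
      exact heV (this ▸ hcV t₀ ht₀)
    -- the endpoint property: `e ≪ c t₀`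
    have hep : c t₀ ∈ g.chronologicalFuture τ {e} := hE hJ hcJ he ht₁J ht₀J ht₁₀
    have hep' : e ∈ g.chronologicalPast τ {c t₀} := mem_chronologicalPast_of_mem_chronologicalFuture hep
    -- where is `e`? Not on `S`, not in `I⁻(S)`; hence in `I⁺(S)`
    have heS : e ∉ S := by
      intro heS
      by_cases heA : e ∈ A
      · exact heV (hAV heA)
      · -- `e ∈ S ∖ A`, so `c t₀ ∈ I⁺(S ∖ A) ⊆ F`
        exact hVF' _ (hcV t₀ ht₀) (Or.inl (Or.inl
          (chronologicalFuture_mono (singleton_subset_iff.2 (show e ∈ S \ A from ⟨heS, heA⟩))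
            hep)))
    have hePast : e ∉ g.chronologicalPast τ S := by
      intro heP
      obtain ⟨t, htJ, htP⟩ := he.exists_mem_of_mem_nhds ⟨t₀, ht₀J⟩
        ((isOpen_chronologicalPast_of_boundaryless g τ S).mem_nhds heP)
      exact Set.disjoint_left.mp hdisj (hIJ t (hJs htJ)) htP
    have heFut : e ∈ g.chronologicalFuture τ S := by
      rcases hS.mem_chronologicalFuture_union_chronologicalPast hn heS with h | h
      · exact h
      · exact absurd h hePast
    -- the open neighbourhood `I⁻(c t₀) ∩ I⁺(S)` of `e` meets `F`
    have hN : g.chronologicalPast τ {c t₀} ∩ g.chronologicalFuture τ S ∈ 𝓝 e :=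
      ((isOpen_chronologicalPast_of_boundaryless g τ _).inter
        (isOpen_chronologicalFuture_of_boundaryless g τ S)).mem_nhds ⟨hep', heFut⟩
    obtain ⟨f, ⟨hfp, hfS⟩, hfF⟩ := mem_closure_iff_nhds.1 heF _ hN
    have hfp' : c t₀ ∈ g.chronologicalFuture τ {f} := mem_chronologicalFuture_of_mem_chronologicalPast hfp
    rcases hfF with (hf | hf) | hf
    · -- `f ∈ I⁺(S ∖ A)`: then `c t₀ ∈ I⁺(S ∖ A)`
      exact hVF' _ (hcV t₀ ht₀) (Or.inl (Or.inl (mem_chronologicalFuture_trans hf hfp')))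
    · -- `f ∈ I⁻(S ∖ A) ⊆ I⁻(S)`, impossible in `I⁺(S)`
      exact Set.disjoint_left.mp hdisj hfS (chronologicalPast_mono (fun x hx ↦ hx.1) hf)
    · -- `f ∈ S ∖ A`: then `c t₀ ∈ I⁺(S ∖ A)`
      refine hVF' _ (hcV t₀ ht₀) (Or.inl (Or.inl ?_))
      rw [chronologicalFuture_eq_biUnion]
      exact mem_biUnion hf hfp'

/-! ### The Cauchy property of `A` in the region `V` -/

/-- **`A` is a Cauchy hypersurface of the region `V`.** Let `S` be a Cauchy hypersurface of
`(M, g, τ)` (Hausdorff, second countable, without boundary, finite-dimensional, `C²`), `A ⊆ S`,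
`F = I⁺(S ∖ A) ∪ I⁻(S ∖ A) ∪ (S ∖ A)`, and `V ⊇ A` an open set disjoint from `closure F` and
relatively closed in its complement (e.g. the complement of `closure F` itself, or one of its
connected components). Assume the endpoint property of timelike curves for `τ` and for
`τ.reverse` (`hE`, `hE'`). Then `A` is a Cauchy hypersurface of the open sub-spacetime
`(V, g|_V, τ|_V)`: an endless timelike curve of `V` is a timelike curve of `M` without endpoints
in `V`; if it missed `A` it would miss `S`, lie on one side of `S`, and
`false_of_curve_in_cauchyPieceDomain` (or its time dual) applies; it meets `S ⊇ A` at most once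
(`IsCauchyHypersurface.eq_of_mem_of_mem_opens`). Hawking–Ellis 1973, Prop. 6.6.3 / §6.5;
O'Neill 1983, Ch. 14, Lemma 14.43 and Thm. 14.38 (the Cauchy development `D(A)` of an acausal
hypersurface is globally hyperbolic with Cauchy hypersurface `A`), here for open pieces of a Cauchy
hypersurface and with `V` in place of `D(A)`. [cite: ONeillSemiRiemannian1983, Ch. 14, Lemma 14.43 and Thm. 14.38 (pp. 425–426)] -/
theorem IsCauchyHypersurface.restrict_of_disjoint_closure (hn : 2 ≤ n)
    (hE : ∀ {c : ℝ → M} {s : Set ℝ} {e : M} {t t' : ℝ}, s.OrdConnected →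
      g.IsFutureTimelikeCurveOn τ c s → HasPastEndpoint c s e → t ∈ s → t' ∈ s → t < t' →
      c t' ∈ g.chronologicalFuture τ {e})
    (hE' : ∀ {c : ℝ → M} {s : Set ℝ} {e : M} {t t' : ℝ}, s.OrdConnected →
      g.IsFutureTimelikeCurveOn τ.reverse c s → HasPastEndpoint c s e → t ∈ s → t' ∈ s → t < t' →
      c t' ∈ g.chronologicalFuture τ.reverse {e})
    (hres : PseudoRiemannianMetric.contMDiff_restrict (I := I) (n := n) (M := M))
    (hτ : τ.contMDiff_restrict) {S A : Set M} (hS : g.IsCauchyHypersurface τ S) (hAS : A ⊆ S)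
    (V : Opens M) (hAV : A ⊆ V)
    (hVF : Disjoint (V : Set M) (closure (g.chronologicalFuture τ (S \ A) ∪
      g.chronologicalPast τ (S \ A) ∪ (S \ A))))
    (hVcl : closure (V : Set M) \ closure (g.chronologicalFuture τ (S \ A) ∪
      g.chronologicalPast τ (S \ A) ∪ (S \ A)) ⊆ V) :
    (g.restrict hres V).IsCauchyHypersurface (τ.restrict hres hτ V) (Subtype.val ⁻¹' A) := by
  set F : Set M := g.chronologicalFuture τ (S \ A) ∪ g.chronologicalPast τ (S \ A) ∪ (S \ A)
    with hF_def
  intro γ s hγ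
  obtain ⟨hs, hγt, hγf, hγp⟩ := hγ
  have hcM : g.IsFutureTimelikeCurveOn τ (Subtype.val ∘ γ) s :=
    (isFutureTimelikeCurveOn_restrict_iff g τ hres hτ V).1 hγt
  -- existence of a crossing
  have hexists : ∃ t ∈ s, (γ t : M) ∈ A := by
    by_contra hmissA
    push Not at hmissA
    have hcV : ∀ t ∈ s, (Subtype.val ∘ γ) t ∈ (V : Set M) := fun t _ ↦ (γ t).2
    have hVF' : ∀ x ∈ (V : Set M), x ∉ F := fun x hxV hxF ↦
      Set.disjoint_left.1 hVF hxV (subset_closure hxF)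
    have hmissS : ∀ t ∈ s, (Subtype.val ∘ γ) t ∉ S := fun t ht htS ↦
      hVF' _ (hcV t ht) (Or.inr ⟨htS, hmissA t ht⟩)
    have hendP : ∀ e ∈ (V : Set M), ¬ HasPastEndpoint (Subtype.val ∘ γ) s e := fun e he h ↦
      hγp.2 ⟨e, he⟩ (hasPastEndpoint_subtypeVal_comp_iff.1 h)
    have hendF : ∀ e ∈ (V : Set M), ¬ HasFutureEndpoint (Subtype.val ∘ γ) s e := fun e he h ↦
      hγf.2 ⟨e, he⟩ (hasFutureEndpoint_subtypeVal_comp_iff.1 h)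
    obtain ⟨t₀, ht₀⟩ := hγf.1
    rcases hS.mem_chronologicalFuture_union_chronologicalPast hn (hmissS t₀ ht₀) with hp | hp
    · exact false_of_curve_in_cauchyPieceDomain hn hE hS hAV hVF hVcl hs hcM hcV hmissS hendP
        ht₀ hp
    · -- time dual: reverse the time orientation and the parameter
      have hFrev : g.chronologicalFuture τ.reverse (S \ A) ∪ g.chronologicalPast τ.reverse (S \ A) ∪
          (S \ A) = F := by
        rw [chronologicalPast_reverse, hF_def]
        show g.chronologicalPast τ (S \ A) ∪ g.chronologicalFuture τ (S \ A) ∪ (S \ A) = _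
        rw [union_comm (g.chronologicalPast τ (S \ A))]
      have hc' : g.IsFutureTimelikeCurveOn τ.reverse (fun t ↦ (Subtype.val ∘ γ) (-t))
          (Neg.neg ⁻¹' s) := hcM.comp_neg
      have ht₀' : -t₀ ∈ Neg.neg ⁻¹' s := by show -(-t₀) ∈ s; rw [neg_neg]; exact ht₀
      have hp' : (fun t ↦ (Subtype.val ∘ γ) (-t)) (-t₀) ∈ g.chronologicalFuture τ.reverse S := by
        show (Subtype.val ∘ γ) (-(-t₀)) ∈ g.chronologicalPast τ S
        rw [neg_neg]
        exact hp
      refine false_of_curve_in_cauchyPieceDomain (τ := τ.reverse) hn hE' hS.reverse hAV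
        (by rw [hFrev]; exact hVF) (by rw [hFrev]; exact hVcl) (ordConnected_preimage_neg hs) hc'
        (fun t ht ↦ hcV (-t) ht) (fun t ht ↦ hmissS (-t) ht) (fun e he ↦ ?_) ht₀' hp'
      rw [hasPastEndpoint_comp_neg_iff]
      exact hendF e he
  obtain ⟨t₁, ht₁, ht₁A⟩ := hexists
  refine ⟨t₁, ⟨ht₁, ht₁A⟩, fun t₂ ht₂ ↦ ?_⟩
  exact IsCauchyHypersurface.eq_of_mem_of_mem_opens hres hτ hn hS hs hγt ht₂.1 ht₁ (hAS ht₂.2)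
    (hAS ht₁A)

/-- **The region `M ∖ closure (I⁺(S ∖ A) ∪ I⁻(S ∖ A) ∪ (S ∖ A))` is a spacetime in which `A` is a
Cauchy hypersurface**, provided `A ⊆ S` does not meet that closure (which holds for open pieces of
spacelike Cauchy hypersurfaces). Hawking–Ellis 1973, Prop. 6.6.3; O'Neill 1983, Ch. 14,
Lemma 14.43 / Thm. 14.38. [cite: ONeillSemiRiemannian1983, Ch. 14, Lemma 14.43 and Thm. 14.38 (pp. 425–426)] -/
theorem IsCauchyHypersurface.restrict_compl_closure (hn : 2 ≤ n)
    (hE : ∀ {c : ℝ → M} {s : Set ℝ} {e : M} {t t' : ℝ}, s.OrdConnected →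
      g.IsFutureTimelikeCurveOn τ c s → HasPastEndpoint c s e → t ∈ s → t' ∈ s → t < t' →
      c t' ∈ g.chronologicalFuture τ {e})
    (hE' : ∀ {c : ℝ → M} {s : Set ℝ} {e : M} {t t' : ℝ}, s.OrdConnected →
      g.IsFutureTimelikeCurveOn τ.reverse c s → HasPastEndpoint c s e → t ∈ s → t' ∈ s → t < t' →
      c t' ∈ g.chronologicalFuture τ.reverse {e})
    (hres : PseudoRiemannianMetric.contMDiff_restrict (I := I) (n := n) (M := M))
    (hτ : τ.contMDiff_restrict) {S A : Set M} (hS : g.IsCauchyHypersurface τ S) (hAS : A ⊆ S)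
    (hA : Disjoint A (closure (g.chronologicalFuture τ (S \ A) ∪
      g.chronologicalPast τ (S \ A) ∪ (S \ A)))) :
    ∃ V : Opens M, (V : Set M) = (closure (g.chronologicalFuture τ (S \ A) ∪
      g.chronologicalPast τ (S \ A) ∪ (S \ A)))ᶜ ∧ A ⊆ V ∧
      (g.restrict hres V).IsCauchyHypersurface (τ.restrict hres hτ V) (Subtype.val ⁻¹' A) := by
  set F : Set M := g.chronologicalFuture τ (S \ A) ∪ g.chronologicalPast τ (S \ A) ∪ (S \ A)
    with hF_def
  refine ⟨⟨(closure F)ᶜ, isClosed_closure.isOpen_compl⟩, rfl, ?_, ?_⟩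
  · exact Set.disjoint_left.1 hA
  · refine hS.restrict_of_disjoint_closure hn hE hE' hres hτ hAS _ (Set.disjoint_left.1 hA)
      disjoint_compl_left ?_
    exact fun x hx ↦ hx.2

/-- **Connected version.** Under the hypotheses of `IsCauchyHypersurface.restrict_compl_closure`,
if `A` is preconnected and `M` locally connected, the connected component `V` of
`M ∖ closure (I⁺(S ∖ A) ∪ I⁻(S ∖ A) ∪ (S ∖ A))` containing a point of `A` is a connected open
sub-spacetime containing `A` in which `A` is a Cauchy hypersurface. O'Neill 1983, Ch. 14,
Lemma 14.43 / Thm. 14.38. [cite: ONeillSemiRiemannian1983, Ch. 14, Lemma 14.43 and Thm. 14.38 (pp. 425–426)] -/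
theorem IsCauchyHypersurface.exists_isConnected_restrict [LocallyConnectedSpace M] (hn : 2 ≤ n)
    (hE : ∀ {c : ℝ → M} {s : Set ℝ} {e : M} {t t' : ℝ}, s.OrdConnected →
      g.IsFutureTimelikeCurveOn τ c s → HasPastEndpoint c s e → t ∈ s → t' ∈ s → t < t' →
      c t' ∈ g.chronologicalFuture τ {e})
    (hE' : ∀ {c : ℝ → M} {s : Set ℝ} {e : M} {t t' : ℝ}, s.OrdConnected →
      g.IsFutureTimelikeCurveOn τ.reverse c s → HasPastEndpoint c s e → t ∈ s → t' ∈ s → t < t' →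
      c t' ∈ g.chronologicalFuture τ.reverse {e})
    (hres : PseudoRiemannianMetric.contMDiff_restrict (I := I) (n := n) (M := M))
    (hτ : τ.contMDiff_restrict) {S A : Set M} (hS : g.IsCauchyHypersurface τ S) (hAS : A ⊆ S)
    (hA : Disjoint A (closure (g.chronologicalFuture τ (S \ A) ∪
      g.chronologicalPast τ (S \ A) ∪ (S \ A))))
    (hAc : IsPreconnected A) {a₀ : M} (ha₀ : a₀ ∈ A) :
    ∃ V : Opens M, IsConnected (V : Set M) ∧ A ⊆ V ∧
      Disjoint (V : Set M) (closure (g.chronologicalFuture τ (S \ A) ∪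
        g.chronologicalPast τ (S \ A) ∪ (S \ A))) ∧
      (g.restrict hres V).IsCauchyHypersurface (τ.restrict hres hτ V) (Subtype.val ⁻¹' A) := by
  set F : Set M := g.chronologicalFuture τ (S \ A) ∪ g.chronologicalPast τ (S \ A) ∪ (S \ A)
    with hF_def
  set V₀ : Set M := (closure F)ᶜ with hV₀
  have hV₀o : IsOpen V₀ := isClosed_closure.isOpen_compl
  have hAV₀ : A ⊆ V₀ := Set.disjoint_left.1 hA
  set V₁ : Set M := connectedComponentIn V₀ a₀ with hV₁
  have hV₁o : IsOpen V₁ := hV₀o.connectedComponentIn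
  have hV₁sub : V₁ ⊆ V₀ := connectedComponentIn_subset _ _
  have ha₀V₀ : a₀ ∈ V₀ := hAV₀ ha₀
  have hAV₁ : A ⊆ V₁ := hAc.subset_connectedComponentIn ha₀ hAV₀
  refine ⟨⟨V₁, hV₁o⟩, ?_, hAV₁, ?_, ?_⟩
  · exact ⟨⟨a₀, mem_connectedComponentIn ha₀V₀⟩, isPreconnected_connectedComponentIn⟩
  · exact Set.disjoint_left.2 fun x hx hxF ↦ hV₁sub hx hxF
  · refine hS.restrict_of_disjoint_closure hn hE hE' hres hτ hAS _ hAV₁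
      (Set.disjoint_left.2 fun x hx hxF ↦ hV₁sub hx hxF) ?_
    -- `V₁` is relatively closed in `V₀`
    rintro x ⟨hxcl, hxF⟩
    have hxV₀ : x ∈ V₀ := hxF
    obtain ⟨U, hUV₀, hUo, hxU, hUc⟩ :=
      (locallyConnectedSpace_iff_subsets_isOpen_isConnected.1 inferInstance) x V₀
        (hV₀o.mem_nhds hxV₀)
    obtain ⟨y, hyU, hyV₁⟩ : (U ∩ V₁).Nonempty := mem_closure_iff_nhds.1 hxcl U (hUo.mem_nhds hxU)
    have hpre : IsPreconnected (V₁ ∪ U) :=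
      isPreconnected_connectedComponentIn.union y hyV₁ hyU hUc.isPreconnected
    have hsub : V₁ ∪ U ⊆ V₁ :=
      hpre.subset_connectedComponentIn (Or.inl (mem_connectedComponentIn ha₀V₀))
        (union_subset hV₁sub hUV₀)
    exact hsub (Or.inr hxU)

end Aux

end LorentzianMetric

end Literature.Geometry.Lorentzian

end
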